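import Mathlib
import HarnessLib
import Summits.ResolutionOfSingularities.ResolutionOfSingularities.Theorems.WildQuotientsWildQuotientResolutionS1aA1Move2Cover
import Summits.ResolutionOfSingularities.ResolutionOfSingularities.Theorems.WildQuotientsWildQuotientResolutionS1aD4Move3Ring

/-!
# S1a — INSTANCE I-3 (D₄), ring level, MOVE 3: the σ-fixed norm cover `((Y^{dp}·V₀)^{d₃}, N₃^{2dd₃})` of `B₊(Y, w)`, `hrad`, degrees

[OURS · L1 W4.5c · lead-1 g13; plan-1 RULING R-F15e, X-CERT v1.1 §2 / v1.2-D4ROWS move 3 «N(x₂) KILLED, [X₀″]₂ RESIDUAL», NOTES `D4 TREE OF RECORD`;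
pattern of ✓`…S1aA1Move2Cover`] — NOT statements of the manuscript; counted 0; AI-level work, weaker than expert review. Crux stmt-ResolutionOfSingularities-17941
`CyclicQuotientFourfolds`, line `s1a-logminvertex` v13 (`stub_reachLowerInFX`).

Abstract setting of ✓`…S1aD4Move3Ring`: a ring `P` (the model of the `[z′]` chart) with `τ`, elements `t, s, Y, X₁, w` (`τ w = w + s²tY`; `t, s, Y` fixed) and a
`τ`-fixed unit `V₀` with inverse `Vi` (in the leaf: `V₀ = η·Z⁻ᵈᵖ`, making `Y^{dp}V₀` of degree 0); centre `(Y, w)`, weights `(2, 1)`; `dbar = d(2p)`. With the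
NORM `N₃ = ∏_{i : ZMod p} (w + i·s²tY) = ∏ σⁱ(w)`:
* `d4m3_norm_fixed/_mem/_T/_deg`; cover `d4m3_cover_zero_mem/_fixed/_deg` (`y₀ = (Y^{dp}V₀)^{d₃} ∈ 𝒥_{d₃·dbar}`), `d4m3_cover_one_mem/_fixed`
  (`y₁ = N₃^{2dd₃}`); `d4m3_hf` (degrees `(θ, 0)` of the centre, `θ` abstract); `d4m3_coverElement_one_eq`;
* ★ `d4m3_hrad` — `YT², wT ∈ √(y₀T^{d₃dbar}, y₁T^{d₃dbar})`.
-/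

set_option linter.dupNamespace false

noncomputable section

open Literature.AlgebraicGeometry.Resolution
open scoped LaurentPolynomial
open Summit.ResolutionOfSingularities.ResolutionOfSingularities.Theorems.WildQuotientResolution.S1.CoarseChart
open Summit.ResolutionOfSingularities.ResolutionOfSingularities.Theorems.WildQuotientResolution.S1.BlowupCharts
open Summit.ResolutionOfSingularities.ResolutionOfSingularities.Theorems.WildQuotientResolution.S1.ReesBigrading
open Summit.ResolutionOfSingularities.ResolutionOfSingularities.Theorems.WildQuotientResolution.S1.KillCert.A1

namespace Summit.ResolutionOfSingularities.ResolutionOfSingularities.Theorems.WildQuotientResolution.S1.KillCert.D4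

variable {P : Type} [CommRing P] (τ : P ≃+* P) (t s Y X₁ w Vi V₀ : P)
  (ht : τ t = t) (hs : τ s = s) (hX₀ : τ Y = Y) (hx₂ : τ w = w + s ^ 2 * t * Y) (hV₀ : τ V₀ = V₀) (hηη : Vi * V₀ = 1)
  {p : ℕ} (d d₃ : ℕ)

/-! ## The norm `N₂` and the cover -/

include ht hs hX₀ hx₂ in
/-- `τ N₃ = N₃`. -/
theorem d4m3_norm_fixed [NeZero p] [CharP P p] (hp1 : p ≠ 1) :
    τ (∏ i : ZMod p, (w + (i.val : P) * (s ^ 2 * t * Y))) = ∏ i : ZMod p, (w + (i.val : P) * (s ^ 2 * t * Y)) :=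
  prod_shift_fixed hp1 τ w (s ^ 2 * t * Y) hx₂ (by rw [map_mul, map_mul, map_pow, hs, ht, hX₀])

/-- `N₂ ∈ 𝒥′_p`. -/
theorem d4m3_norm_mem [NeZero p] : (∏ i : ZMod p, (w + (i.val : P) * (s ^ 2 * t * Y))) ∈ (weightedFiltration (![Y, w] : Fin 2 → P) ![2, 1]).ideal p := by
  have h1 : ∀ i : ZMod p, w + (i.val : P) * (s ^ 2 * t * Y) ∈ (weightedFiltration (![Y, w] : Fin 2 → P) ![2, 1]).ideal 1 := fun i =>
    add_mem (mem_weightedFiltration_ideal (![Y, w] : Fin 2 → P) ![2, 1] 1)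
      (Ideal.mul_mem_left _ _ (Ideal.mul_mem_left _ _ ((weightedFiltration (![Y, w] : Fin 2 → P) ![2, 1]).antitone (by norm_num : 1 ≤ 2)
        (mem_weightedFiltration_ideal (![Y, w] : Fin 2 → P) ![2, 1] 0))))
  have := Ideal.prod_mem_prod (s := (Finset.univ : Finset (ZMod p))) (fun i _ => h1 i)
  rw [Finset.prod_const, Finset.card_univ, ZMod.card] at this
  have hle := Veronese.idealFiltration_pow_le (weightedFiltration (![Y, w] : Fin 2 → P) ![2, 1]) 1 p
  rw [one_mul] at hle
  exact hle this

/-- **Cover element 0** of move 3: `y₀ = (Y^{dp}·V₀)^{d₃} ∈ 𝒥_{d₃·dbar}`. -/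
theorem d4m3_cover_zero_mem : (Y ^ (d * p) * V₀) ^ d₃ ∈ (weightedFiltration (![Y, w] : Fin 2 → P) ![2, 1]).ideal (d₃ * (d * (2 * p))) := by
  have h0 : Y ^ (d * p) ∈ (weightedFiltration (![Y, w] : Fin 2 → P) ![2, 1]).ideal (d * (2 * p)) := by
    have h := Ideal.pow_mem_pow (mem_weightedFiltration_ideal (![Y, w] : Fin 2 → P) ![2, 1] 0) (d * p)
    have hle := Veronese.idealFiltration_pow_le (weightedFiltration (![Y, w] : Fin 2 → P) ![2, 1]) 2 (d * p)
    have e1 : 2 * (d * p) = d * (2 * p) := by ring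
    rw [e1] at hle
    exact hle h
  have h1 : Y ^ (d * p) * V₀ ∈ (weightedFiltration (![Y, w] : Fin 2 → P) ![2, 1]).ideal (d * (2 * p)) := Ideal.mul_mem_right _ _ h0
  have h := Ideal.pow_mem_pow h1 d₃
  have hle := Veronese.idealFiltration_pow_le (weightedFiltration (![Y, w] : Fin 2 → P) ![2, 1]) (d * (2 * p)) d₃
  have e1 : d * (2 * p) * d₃ = d₃ * (d * (2 * p)) := by ring
  rw [e1] at hle
  exact hle h

/-- **Cover element 1** of move 2: `y′₁ = N₂^{2dd₃} ∈ 𝒥′_{d₃·dbar}`. -/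
theorem d4m3_cover_one_mem [NeZero p] :
    (∏ i : ZMod p, (w + (i.val : P) * (s ^ 2 * t * Y))) ^ (2 * d * d₃) ∈ (weightedFiltration (![Y, w] : Fin 2 → P) ![2, 1]).ideal (d₃ * (d * (2 * p))) := by
  have h := Ideal.pow_mem_pow (d4m3_norm_mem t s Y w (p := p)) (2 * d * d₃)
  have hle := Veronese.idealFiltration_pow_le (weightedFiltration (![Y, w] : Fin 2 → P) ![2, 1]) p (2 * d * d₃)
  have e1 : p * (2 * d * d₃) = d₃ * (d * (2 * p)) := by ring
  rw [e1] at hle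
  exact hle h

include hX₀ hV₀ in
/-- `y′₀` is `τ`-fixed. -/
theorem d4m3_cover_zero_fixed : τ ((Y ^ (d * p) * V₀) ^ d₃) = (Y ^ (d * p) * V₀) ^ d₃ := by
  rw [map_pow, map_mul, map_pow, hX₀, hV₀]

include ht hs hX₀ hx₂ in
/-- `y₁` is `τ`-fixed. -/
theorem d4m3_cover_one_fixed [NeZero p] [CharP P p] (hp1 : p ≠ 1) :
    τ ((∏ i : ZMod p, (w + (i.val : P) * (s ^ 2 * t * Y))) ^ (2 * d * d₃)) = (∏ i : ZMod p, (w + (i.val : P) * (s ^ 2 * t * Y))) ^ (2 * d * d₃) := by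
  rw [map_pow, d4m3_norm_fixed τ t s Y w ht hs hX₀ hx₂ hp1]

/-! ## `hrad` in `R^w(P; Y, w)` -/

/-- `N₃·T^p = ∏ (wT + i·s²t·(YT²·T⁻¹))` in `P[T;T⁻¹]`. -/
theorem d4m3_norm_T [NeZero p] : LaurentPolynomial.C (∏ i : ZMod p, (w + (i.val : P) * (s ^ 2 * t * Y))) * LaurentPolynomial.T (p : ℤ) =
    ∏ i : ZMod p, (LaurentPolynomial.C w * LaurentPolynomial.T 1 +
      (i.val : P[T;T⁻¹]) * (LaurentPolynomial.C (s ^ 2 * t) * (LaurentPolynomial.T (-1) * (LaurentPolynomial.C Y * LaurentPolynomial.T 2)))) := by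
  have hfac : ∀ i : ZMod p, LaurentPolynomial.C w * LaurentPolynomial.T 1 +
      (i.val : P[T;T⁻¹]) * (LaurentPolynomial.C (s ^ 2 * t) * (LaurentPolynomial.T (-1) * (LaurentPolynomial.C Y * LaurentPolynomial.T 2))) =
      LaurentPolynomial.C (w + (i.val : P) * (s ^ 2 * t * Y)) * LaurentPolynomial.T 1 := by
    intro i
    have hT : (LaurentPolynomial.T (-1) : P[T;T⁻¹]) * LaurentPolynomial.T 2 = LaurentPolynomial.T 1 := by
      rw [← LaurentPolynomial.T_add]; norm_num
    simp only [map_add, map_mul, map_natCast]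
    rw [← hT]
    ring
  simp_rw [hfac]
  rw [Finset.prod_mul_distrib, ← map_prod, Finset.prod_const, Finset.card_univ, ZMod.card, LaurentPolynomial.T_pow, mul_one]

include hηη in
/-- ★ **`hrad` for move 3 of MT-D₄**: with the cover `y₀ = (Y^{dp}V₀)^{d₃}`, `y₁ = N₃^{2dd₃}` of degree `d₃·d(2p)`, both generators `YT²`, `wT` of the
irrelevant ideal of `R^w(P; Y, w)` lie in `√(y₀T^{d₃dbar}, y₁T^{d₃dbar})`. [OURS · L1 W4.5c · D₄ move 3] -/
theorem d4m3_hrad [NeZero p] (c₀ c₁ : ↥(cobordantAlgebra (![Y, w] : Fin 2 → P) ![2, 1]))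
    (hc₀ : (c₀ : P[T;T⁻¹]) = LaurentPolynomial.C ((Y ^ (d * p) * V₀) ^ d₃) * LaurentPolynomial.T ((d₃ * (d * (2 * p)) : ℕ) : ℤ))
    (hc₁ : (c₁ : P[T;T⁻¹]) = LaurentPolynomial.C ((∏ i : ZMod p, (w + (i.val : P) * (s ^ 2 * t * Y))) ^ (2 * d * d₃)) *
      LaurentPolynomial.T ((d₃ * (d * (2 * p)) : ℕ) : ℤ)) (i : Fin 2) :
    cobordantAlgebra.u' (![Y, w] : Fin 2 → P) ![2, 1] i ∈ (Ideal.span ({c₀, c₁} : Set ↥(cobordantAlgebra (![Y, w] : Fin 2 → P) ![2, 1]))).radical := by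
  set Y₀ := cobordantAlgebra.u' (![Y, w] : Fin 2 → P) ![2, 1] 0 with hY₀def
  set Y₂ := cobordantAlgebra.u' (![Y, w] : Fin 2 → P) ![2, 1] 1 with hY₂def
  set s₂ := cobordantAlgebra.s (![Y, w] : Fin 2 → P) ![2, 1] with hs₂def
  -- `Y'^{dp d₃} = c₀ · Vi^{d₃}`
  have hY0 : Y₀ ^ (d * p * d₃) = c₀ * algebraMap P _ (Vi ^ d₃) := by
    refine Subtype.ext ?_
    rw [SubmonoidClass.coe_pow, MulMemClass.coe_mul, hY₀def, cobordantAlgebra.coe_u', cobordantAlgebra.coe_algebraMap, hc₀]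
    change (LaurentPolynomial.C Y * LaurentPolynomial.T ((2 : ℕ) : ℤ)) ^ (d * p * d₃) = _
    have hXη : (Y ^ (d * p) * V₀) ^ d₃ * Vi ^ d₃ = Y ^ (d * p * d₃) := by
      rw [← mul_pow, mul_assoc, mul_comm V₀, hηη, mul_one, ← pow_mul]
    rw [mul_pow, ← map_pow, LaurentPolynomial.T_pow, mul_right_comm (LaurentPolynomial.C ((Y ^ (d * p) * V₀) ^ d₃)), ← map_mul, hXη,
      show ((d * p * d₃ : ℕ) : ℤ) * ((2 : ℕ) : ℤ) = ((d₃ * (d * (2 * p)) : ℕ) : ℤ) by push_cast; ring]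
  have hY0rad : Y₀ ∈ (Ideal.span ({c₀, c₁} : Set ↥(cobordantAlgebra (![Y, w] : Fin 2 → P) ![2, 1]))).radical := by
    refine ⟨d * p * d₃, ?_⟩
    rw [hY0]
    exact Ideal.mul_mem_right _ _ (Ideal.subset_span (by simp))
  fin_cases i
  · exact hY0rad
  · change Y₂ ∈ _
    have hprod : (∏ j : ZMod p, (Y₂ + algebraMap P _ ((j.val : P) * (s ^ 2 * t)) * (s₂ * Y₀))) ^ (2 * d * d₃) = c₁ := by
      refine Subtype.ext ?_
      rw [SubmonoidClass.coe_pow, SubmonoidClass.coe_finsetProd, hc₁]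
      have hj : ∀ j : ZMod p, ((Y₂ + algebraMap P _ ((j.val : P) * (s ^ 2 * t)) * (s₂ * Y₀) : ↥(cobordantAlgebra (![Y, w] : Fin 2 → P) ![2, 1])) : P[T;T⁻¹]) =
          LaurentPolynomial.C w * LaurentPolynomial.T 1 +
            (j.val : P[T;T⁻¹]) * (LaurentPolynomial.C (s ^ 2 * t) * (LaurentPolynomial.T (-1) * (LaurentPolynomial.C Y * LaurentPolynomial.T 2))) := by
        intro j
        rw [AddMemClass.coe_add, MulMemClass.coe_mul, MulMemClass.coe_mul, hY₂def, hY₀def, hs₂def, cobordantAlgebra.coe_u', cobordantAlgebra.coe_u',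
          cobordantAlgebra.coe_s, cobordantAlgebra.coe_algebraMap, map_mul, map_natCast]
        simp only [Matrix.cons_val_zero, Matrix.cons_val_one]
        push_cast
        ring
      simp_rw [hj]
      rw [← d4m3_norm_T t s Y w (p := p), mul_pow, ← map_pow, LaurentPolynomial.T_pow]
      congr 2
      push_cast
      ring
    have hdiff : (∏ j : ZMod p, (Y₂ + algebraMap P _ ((j.val : P) * (s ^ 2 * t)) * (s₂ * Y₀))) - Y₂ ^ p ∈ Ideal.span {s₂ * Y₀} :=
      prod_add_mul_sub_pow_mem Y₂ (s₂ * Y₀) fun j => algebraMap P _ ((j.val : P) * (s ^ 2 * t))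
    have hrad1 : s₂ * Y₀ ∈ (Ideal.span ({c₀, c₁} : Set ↥(cobordantAlgebra (![Y, w] : Fin 2 → P) ![2, 1]))).radical :=
      Ideal.mul_mem_left _ _ hY0rad
    have hP : (∏ j : ZMod p, (Y₂ + algebraMap P _ ((j.val : P) * (s ^ 2 * t)) * (s₂ * Y₀))) ∈
        (Ideal.span ({c₀, c₁} : Set ↥(cobordantAlgebra (![Y, w] : Fin 2 → P) ![2, 1]))).radical := by
      refine ⟨2 * d * d₃, ?_⟩
      rw [hprod]
      exact Ideal.subset_span (by simp)
    have hYp : Y₂ ^ p ∈ (Ideal.span ({c₀, c₁} : Set ↥(cobordantAlgebra (![Y, w] : Fin 2 → P) ![2, 1]))).radical := by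
      have h2 : (∏ j : ZMod p, (Y₂ + algebraMap P _ ((j.val : P) * (s ^ 2 * t)) * (s₂ * Y₀))) - Y₂ ^ p ∈
          (Ideal.span ({c₀, c₁} : Set ↥(cobordantAlgebra (![Y, w] : Fin 2 → P) ![2, 1]))).radical :=
        (Ideal.span_singleton_le_iff_mem _ |>.mpr hrad1) hdiff
      have := sub_mem hP h2
      rwa [sub_sub_cancel] at this
    exact Ideal.mem_radical_of_pow_mem hYp

/-! ## Degrees -/

section Degrees

variable {m : ℕ} (r : Fin m → ℕ) (𝒜 : (Π j : Fin m, ZMod (r j)) → AddSubgroup P) [GradedRing 𝒜] (θ : Π j : Fin m, ZMod (r j))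
  (hX₀d : Y ∈ 𝒜 θ) (hx₂d : w ∈ 𝒜 0) (hδd : s ^ 2 * t * Y ∈ 𝒜 0) (hy₀d : Y ^ (d * p) * V₀ ∈ 𝒜 0)

omit [GradedRing 𝒜] in
include hX₀d hx₂d in
/-- The centre `(Y, w)` is homogeneous of degrees `(θ, 0)`. -/
theorem d4m3_hf (i : Fin 2) : (![Y, w] : Fin 2 → P) i ∈ 𝒜 ((![θ, 0] : Fin 2 → Π j : Fin m, ZMod (r j)) i) := by
  fin_cases i
  · exact hX₀d
  · exact hx₂d

include hy₀d in
/-- `y₀` has degree 0. -/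
theorem d4m3_cover_zero_deg : (Y ^ (d * p) * V₀) ^ d₃ ∈ 𝒜 0 := by
  have h := SetLike.pow_mem_graded d₃ hy₀d
  rwa [smul_zero] at h

include hx₂d hδd in
/-- `N₃` has degree 0. -/
theorem d4m3_norm_deg [NeZero p] : (∏ i : ZMod p, (w + (i.val : P) * (s ^ 2 * t * Y))) ∈ 𝒜 0 := by
  have hfac : ∀ i : ZMod p, w + (i.val : P) * (s ^ 2 * t * Y) ∈ 𝒜 0 := by
    intro i
    refine add_mem hx₂d ?_
    have hsX : s ^ 2 * t * Y ∈ 𝒜 0 := hδd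
    have hn : ((i.val : P)) ∈ 𝒜 0 := SetLike.natCast_mem_graded _ _
    have := SetLike.mul_mem_graded hn hsX
    rwa [add_zero] at this
  have h := SetLike.prod_mem_graded (A := 𝒜) (i := fun _ => (0 : Π j : Fin m, ZMod (r j))) (g := fun i => w + (i.val : P) * (s ^ 2 * t * Y))
    (F := Finset.univ) (fun i _ => hfac i)
  rwa [Finset.sum_const_zero] at h

end Degrees

/-- `c₁ = (∏_j (Y₂ + j s²·(s₂ Y₀)))^{2dd₃}` for the move-2 cover element `c₁ = N₂^{2dd₃} T^{dbar₂}`. -/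
theorem d4m3_coverElement_one_eq {P : Type} [CommRing P] (t s Y w : P) {p : ℕ} [NeZero p] (d d₃ : ℕ) (c₁ : ↥(cobordantAlgebra (![Y, w] : Fin 2 → P) ![2, 1]))
    (hc₁ : (c₁ : P[T;T⁻¹]) = LaurentPolynomial.C ((∏ i : ZMod p, (w + (i.val : P) * (s ^ 2 * t * Y))) ^ (2 * d * d₃)) *
      LaurentPolynomial.T ((d₃ * (d * (2 * p)) : ℕ) : ℤ)) :
    c₁ = (∏ j : ZMod p, (cobordantAlgebra.u' (![Y, w] : Fin 2 → P) ![2, 1] 1 + algebraMap P _ ((j.val : P) * (s ^ 2 * t)) *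
      (cobordantAlgebra.s (![Y, w] : Fin 2 → P) ![2, 1] * cobordantAlgebra.u' (![Y, w] : Fin 2 → P) ![2, 1] 0))) ^ (2 * d * d₃) := by
  refine Subtype.ext ?_
  rw [SubmonoidClass.coe_pow, SubmonoidClass.coe_finsetProd, hc₁]
  have hj : ∀ j : ZMod p, ((cobordantAlgebra.u' (![Y, w] : Fin 2 → P) ![2, 1] 1 + algebraMap P _ ((j.val : P) * (s ^ 2 * t)) *
      (cobordantAlgebra.s (![Y, w] : Fin 2 → P) ![2, 1] * cobordantAlgebra.u' (![Y, w] : Fin 2 → P) ![2, 1] 0) :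
        ↥(cobordantAlgebra (![Y, w] : Fin 2 → P) ![2, 1])) : P[T;T⁻¹]) =
      LaurentPolynomial.C w * LaurentPolynomial.T 1 +
        (j.val : P[T;T⁻¹]) * (LaurentPolynomial.C (s ^ 2 * t) * (LaurentPolynomial.T (-1) * (LaurentPolynomial.C Y * LaurentPolynomial.T 2))) := by
    intro j
    rw [AddMemClass.coe_add, MulMemClass.coe_mul, MulMemClass.coe_mul, cobordantAlgebra.coe_u', cobordantAlgebra.coe_u', cobordantAlgebra.coe_s,
      cobordantAlgebra.coe_algebraMap, map_mul, map_natCast]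
    simp only [Matrix.cons_val_zero, Matrix.cons_val_one]
    push_cast
    ring
  simp_rw [hj]
  rw [← d4m3_norm_T t s Y w (p := p), mul_pow, ← map_pow, LaurentPolynomial.T_pow]
  congr 2
  push_cast
  ring

end Summit.ResolutionOfSingularities.ResolutionOfSingularities.Theorems.WildQuotientResolution.S1.KillCert.D4

end
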